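import Summits.MatrixMultiplication.OmegaCensus.STPPSmallPatternKernelProduct

/-!
# ω-census, small STPP pattern `(1,2,2)^k`: the kernel mask search (engine; definitions only)

HONEST FRAMING (pub-omega census; verbatim): lottery ticket; floor = certified bounds/negative ranges.
Census STRUCTURE bookkeeping of the STPP track (seat pub-omega-stpp-3, gen 23; STRUCTURE row B5, the threshold column
`T2(H) = max {k : (1,2,2)^k ⊆ H}`, lower side), not progress on `ω`: small patterns in small groups bound no exponent.

Companion of `STPPSmallPatternKernelSearch.lean` (pattern `(2,1,1)^k`) for the pattern `(1,2,2)^k` (`|Aᵢ| = 1`,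
`|Bᵢ| = |Cᵢ| = 2`).  It searches the DIFFERENCE MODEL of the tree's `exists_isSTPP_122_iff` (`STPPSmallPatternCriteria.lean`):
`Aᵢ = {0}`, pairs `Bᵢ = {bᵢ, b'ᵢ}`, `Cᵢ = {cᵢ, c'ᵢ}`; with `Dⱼ = Bⱼ − Cⱼ` (four differences) the criterion reads: the `Dⱼ` are
4-element sets, pairwise disjoint, and disjoint from every mixed difference set `Bᵢ − C_l`, `i ≠ l`.  Same code arithmetic
(`GC`, `zcode`, `prodGC`) and loop idioms (`force`, `allBits`) as the `(2,1,1)` engine; soundness is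
`STPPSmallPatternKernelReflect122.lean`.

* NORMAL FORM: triples sorted by the code of `bᵢ = min Bᵢ`, `b₀ = 0`, `b'₀ = y` from a list of representatives, `c₀ = 0`,
  `bᵢ <code b'ᵢ`, `cᵢ <code c'ᵢ`.
* STATE (`St2`): masks `IN = ⋃ Dⱼ`, `MX = ⋃_{i≠l} (Bᵢ − C_l)`, `NI = −IN`, `NIM = −(IN ∪ MX)`, `BS = ⋃ Bᵢ`, `CS = ⋃ Cᵢ`,
  `PB = ⋃_{u ∈ CS} (IN + u)` (forbidden `b`: `b − u ∈ IN`), `PC = ⋃_{t ∈ BS} (t − IN)` (forbidden `c`), the lists of the old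
  `B`- and `C`-elements, and `lastB`.
* SEARCH: `b ∉ BS ∪ PB`, `b > lastB`; `b' > b` likewise; `c ∉ CS ∪ PC ∪ (b − (IN ∪ MX)) ∪ (b' − (IN ∪ MX))`; `c' > c` likewise;
  then the remaining literal tests (`b − c ≠ b' − c'`, `b − c' ≠ b' − c`, and the new mixed differences avoid the new `D`).
  No room tests, no chunking (the cells of the table are small).  `true` = every branch refuted.

References: H. Cohn, R. Kleinberg, B. Szegedy, C. Umans, FOCS 2005 (arXiv:math/0511460), Def. 5.1.  Record: pub-omega HOME
`pub-omega-stpp-3-g23/` (Python mirror `k122.py` reproduces the complete lister `lister122.c` (gen 22) normal-form counts).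
-/

namespace Summit.MatrixMultiplication.OmegaCensus

namespace STPP122Neg

open STPP211Neg

/-- Search state after some triples (see the file header). -/
structure St2 where
  /-- code of the last `b = min B` -/ lastB : ℕ
  /-- `⋃ Dⱼ` -/ IN : ℕ
  /-- `⋃_{i ≠ l} (Bᵢ − C_l)` -/ MX : ℕ
  /-- `−IN` -/ NI : ℕ
  /-- `−(IN ∪ MX)` -/ NIM : ℕ
  /-- `⋃ Bᵢ` -/ BS : ℕ
  /-- `⋃ Cᵢ` -/ CS : ℕ
  /-- `⋃_{u ∈ CS} (IN + u)` -/ PB : ℕ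
  /-- `⋃_{t ∈ BS} (t − IN)` -/ PC : ℕ
  /-- the old `B`-elements (codes) -/ bs : List ℕ
  /-- the old `C`-elements (codes) -/ cs : List ℕ

/-- The empty state. -/
def St2.empty : St2 := ⟨0, 0, 0, 0, 0, 0, 0, 0, 0, [], []⟩

/-- Conjunction over a list of codes (recursor form). -/
noncomputable def allL (l : List ℕ) (f : ℕ → Bool) : Bool :=
  @List.rec ℕ (fun _ => Bool) true (fun x _ ih => f x && ih) l

/-- Union over a list of codes of masks `f x`, on top of `m₀` (recursor form). -/
noncomputable def orL (l : List ℕ) (f : ℕ → ℕ) (m₀ : ℕ) : ℕ :=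
  @List.rec ℕ (fun _ => ℕ) m₀ (fun x _ ih => Nat.lor ih (f x)) l

/-- The mask of the four new inner differences `{b − c, b − c', b' − c, b' − c'}`. -/
def dMask (g : GC) (b b' c c' : ℕ) : ℕ :=
  Nat.lor (Nat.lor (Nat.lor (bit (g.sub b c)) (bit (g.sub b c'))) (bit (g.sub b' c))) (bit (g.sub b' c'))

/-- The mask of the negatives of the four new inner differences. -/
def ndMask (g : GC) (b b' c c' : ℕ) : ℕ :=
  Nat.lor (Nat.lor (Nat.lor (bit (g.sub c b)) (bit (g.sub c' b))) (bit (g.sub c b'))) (bit (g.sub c' b'))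

/-- The LITERAL TESTS of a new triple against the state: `b − c ≠ b' − c'`, `b − c' ≠ b' − c`, and no new mixed difference
(`t − u` with `t` new, `u` old or `t` old, `u` new) lies in the new `D`. -/
noncomputable def validNew (g : GC) (S : St2) (b b' c c' : ℕ) : Bool :=
  force (dMask g b b' c c') fun D =>
  !(Nat.beq (g.sub b c) (g.sub b' c')) && !(Nat.beq (g.sub b c') (g.sub b' c)) &&
    allL S.cs (fun u => !(Nat.testBit D (g.sub b u)) && !(Nat.testBit D (g.sub b' u))) &&
    allL S.bs (fun t => !(Nat.testBit D (g.sub t c)) && !(Nat.testBit D (g.sub t c')))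

/-- CHILD: the state extended by the triple `(b, b', c, c')` (all masks forced), continued by `k`. -/
noncomputable def child2 (g : GC) (S : St2) (b b' c c' : ℕ) (k : St2 → Bool) : Bool :=
  force (dMask g b b' c c') fun D =>
  force (ndMask g b b' c c') fun ND =>
  force (orL S.cs (fun u => Nat.lor (bit (g.sub b u)) (bit (g.sub b' u)))
    (orL S.bs (fun t => Nat.lor (bit (g.sub t c)) (bit (g.sub t c'))) 0)) fun NMX =>
  force (orL S.cs (fun u => Nat.lor (bit (g.sub u b)) (bit (g.sub u b')))
    (orL S.bs (fun t => Nat.lor (bit (g.sub c t)) (bit (g.sub c' t))) 0)) fun NNMX =>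
  force (Nat.lor S.IN D) fun IN2 =>
  force (Nat.lor S.MX NMX) fun MX2 =>
  force (Nat.lor S.NI ND) fun NI2 =>
  force (Nat.lor (Nat.lor S.NIM ND) NNMX) fun NIM2 =>
  force (Nat.lor (Nat.lor (orL S.cs (fun u => g.tr D u) S.PB) (g.tr IN2 c)) (g.tr IN2 c')) fun PB2 =>
  force (Nat.lor (Nat.lor (orL S.bs (fun t => g.tr ND t) S.PC) (g.tr NI2 b)) (g.tr NI2 b')) fun PC2 =>
  force (Nat.lor (Nat.lor S.BS (bit b)) (bit b')) fun BS2 =>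
  force (Nat.lor (Nat.lor S.CS (bit c)) (bit c')) fun CS2 =>
  k ⟨b, IN2, MX2, NI2, NIM2, BS2, CS2, PB2, PC2, b :: b' :: S.bs, c :: c' :: S.cs⟩

/-- One level below the state `S` (children searched by `k`). -/
noncomputable def level2 (g : GC) (S : St2) (k : St2 → Bool) : Bool :=
  force (Nat.xor g.full (Nat.lor (Nat.lor S.BS S.PB) (Nat.land (lowMask (Nat.add S.lastB 1)) g.full))) fun freeB =>
  allBits freeB (fun b =>
    force (g.tr S.NIM b) fun NIMb =>
    force (Nat.xor g.full (Nat.lor (Nat.xor g.full freeB) (Nat.land (lowMask (Nat.add b 1)) g.full))) fun freeB' =>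
    allBits freeB' (fun b' =>
      force (Nat.xor g.full (Nat.lor (Nat.lor (Nat.lor S.CS S.PC) NIMb) (g.tr S.NIM b'))) fun freeC =>
      allBits freeC (fun c =>
        force (Nat.xor g.full (Nat.lor (Nat.xor g.full freeC) (Nat.land (lowMask (Nat.add c 1)) g.full))) fun freeC' =>
        allBits freeC' (fun c' => !(validNew g S b b' c c') || child2 g S b b' c c' k) freeC')
        freeC)
      freeB')
    freeB

/-- The search below a state with `r` triples still to place (`false` when nothing is left: a full configuration). -/
noncomputable def below2 (g : GC) : ℕ → St2 → Bool :=
  @Nat.rec (fun _ => St2 → Bool) (fun _ => false) (fun _ ih S => level2 g S ih)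

/-- The START for the representative `y` (`B₀ = {0, y}`, `C₀ = {0, c'}` over all `c' > 0` passing the literal tests),
continued by `k`. -/
noncomputable def start2 (g : GC) (y : ℕ) (k : St2 → Bool) : Bool :=
  force (Nat.xor g.full (Nat.land (lowMask 1) g.full)) fun freeC' =>
  allBits freeC' (fun c' => !(validNew g St2.empty 0 y 0 c') || child2 g St2.empty 0 y 0 c' k) freeC'

/-- THE SEARCH for the size pattern `(1,2,2)^k` from the representatives `reps` of `y` (`B₀ = {0, y}`): `true` certifies that
no normal-form solution of the difference model with `y` listed exists (reflection file). -/
noncomputable def search2 (g : GC) (k : ℕ) (reps : List ℕ) : Bool :=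
  @List.rec ℕ (fun _ => Bool) true (fun y _ ih => start2 g y (below2 g (Nat.sub k 1)) && ih) reps

/-- `search2` on a cons. -/
theorem search2_cons (g : GC) (k y : ℕ) (R : List ℕ) :
    search2 g k (y :: R) = (start2 g y (below2 g (k - 1)) && search2 g k R) := rfl

/-- `search2` is a conjunction over the representative list (used to split kernel evaluations). -/
theorem search2_append (g : GC) (k : ℕ) (R₁ R₂ : List ℕ) :
    search2 g k (R₁ ++ R₂) = (search2 g k R₁ && search2 g k R₂) := by
  induction R₁ with
  | nil => rfl
  | cons y R ih => rw [List.cons_append, search2_cons, search2_cons, ih, Bool.and_assoc]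


/-! ## Chunked variant (first-level exclusion masks on `c'₀`, for long cells) -/

/-- The START for the representative `y` with the codes `c'` whose bit is set in `x1` EXCLUDED (chunking of one representative's
subtree across several kernel evaluations), continued by `k`. -/
noncomputable def start2x (g : GC) (y x1 : ℕ) (k : St2 → Bool) : Bool :=
  force (Nat.xor g.full (Nat.land (lowMask 1) g.full)) fun freeC' =>
  allBits freeC' (fun c' => Nat.testBit x1 c' || (!(validNew g St2.empty 0 y 0 c') || child2 g St2.empty 0 y 0 c' k)) freeC'

/-- THE CHUNKED SEARCH over `(y, x1)` pairs (representative, exclusion mask of first-level `c'`-codes): `true` certifies that no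
normal-form solution with `y` listed and the code of `c'₀` outside `x1` exists (reflection: `STPPSmallPatternKernelReflect122X.lean`;
the chunks of each representative must cover all codes). -/
noncomputable def search2x (g : GC) (k : ℕ) (chunks : List (ℕ × ℕ)) : Bool :=
  @List.rec (ℕ × ℕ) (fun _ => Bool) true (fun e _ ih => start2x g e.1 e.2 (below2 g (Nat.sub k 1)) && ih) chunks

/-- `search2x` on a cons. -/
theorem search2x_cons (g : GC) (k : ℕ) (e : ℕ × ℕ) (R : List (ℕ × ℕ)) :
    search2x g k (e :: R) = (start2x g e.1 e.2 (below2 g (k - 1)) && search2x g k R) := rfl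

/-- `search2x` is a conjunction over the chunk list. -/
theorem search2x_append (g : GC) (k : ℕ) (R₁ R₂ : List (ℕ × ℕ)) :
    search2x g k (R₁ ++ R₂) = (search2x g k R₁ && search2x g k R₂) := by
  induction R₁ with
  | nil => rfl
  | cons e R ih => rw [List.cons_append, search2x_cons, search2x_cons, ih, Bool.and_assoc]

end STPP122Neg

end Summit.MatrixMultiplication.OmegaCensus
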